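import Mathlib
import Summits.PneNP.PneNP.Theorems.SfmBlBadSignings
import Literature.MathematicalPhysics.QuantumFieldTheory.Balaban1983to89.B2Sect3AGaussianStep

/-!
# PROOF-SFM-BL Proposition 7 (averaged trace bound) in the abstract output-shared-sign model

FRONTIER F-N1c; nothing here bears on P vs NP.

For `B e ≥ 0` (`≤ 3` legs per output, one-sided unsigned degrees `≤ L`), a piece graph `G ⊇ supp B` of max
degree `≤ Ldeg`, parameters `0 ≤ γ' ≤ γ_sp`, `0 < γ_sp ≤ L`, and the UNSIGNED `(γ_sp, t₀)`-sparseness on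
connected pairs, the signed bipartite doubles `A_T = [[0, M_T],[M_Tᵀ, 0]]`, `M_T = sgnMat B T`, satisfy
`Σ_T tr(A_T^{2k}) ≤ 2^m·N·ρ^{2k} + #bad·N·L^{2k}`, `ρ = 100·γ_sp·(log₂(L/γ_sp)+1)`, `N = |α|+|β|`,
`#bad ≤ 2^m·2N·Σ_{k'∈(t₀,N]} Ldeg^{2(k'-1)} e^{−γ'²k'/(12L)}`:
good signings by `trace_pow_le_of_good` (Bilu–Linial 3.3), bad ones by Schur's test (`trace_pow_le_schur`),
and their number by `card_badSignings_le`; `badWeight_le` + `sum_trace_pow_le_explicit` give the §6 numerics form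
`Σ_T tr ≤ 2^m·(Nρ^{2k} + 4N²L^{2k}/L^{10(t₀+1)+2})` for `γ'² ≥ 144·L·ln L`.  This is the `E_T tr(Ã_T^{2ℓ})` input of Ψ (§6).
-/

namespace Summit.PneNP.PneNP.Theorems.SfmBl

open Matrix Finset BigOperators

variable {α β : Type} [Fintype α] [Fintype β] {m : ℕ}

/-- Row ℓ₁-norms of the bipartite double `[[0,M],[Mᵀ,0]]` are bounded by the row/column ℓ₁-norms of `M`. -/
theorem fromBlocks_row_abs_sum_le (M : Matrix α β ℝ) {L : ℝ} (hrow : ∀ i, ∑ k, |M i k| ≤ L)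
    (hcol : ∀ k, ∑ i, |M i k| ≤ L) (x : α ⊕ β) :
    ∑ y, |(Matrix.fromBlocks (0 : Matrix α α ℝ) M Mᵀ (0 : Matrix β β ℝ)) x y| ≤ L := by
  rw [Fintype.sum_sum_type]
  rcases x with i | k
  · simp only [fromBlocks_apply₁₁, fromBlocks_apply₁₂, Matrix.zero_apply, abs_zero,
      Finset.sum_const_zero, zero_add]
    exact hrow i
  · simp only [fromBlocks_apply₂₁, fromBlocks_apply₂₂, Matrix.transpose_apply, Matrix.zero_apply,
      abs_zero, Finset.sum_const_zero, add_zero]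
    exact hcol k

/-- Column ℓ₁-norms of the bipartite double `[[0,M],[Mᵀ,0]]` are bounded likewise. -/
theorem fromBlocks_col_abs_sum_le (M : Matrix α β ℝ) {L : ℝ} (hrow : ∀ i, ∑ k, |M i k| ≤ L)
    (hcol : ∀ k, ∑ i, |M i k| ≤ L) (y : α ⊕ β) :
    ∑ x, |(Matrix.fromBlocks (0 : Matrix α α ℝ) M Mᵀ (0 : Matrix β β ℝ)) x y| ≤ L := by
  rw [Fintype.sum_sum_type]
  rcases y with i | k
  · simp only [fromBlocks_apply₁₁, fromBlocks_apply₂₁, Matrix.transpose_apply, Matrix.zero_apply,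
      abs_zero, Finset.sum_const_zero, zero_add]
    exact hrow i
  · simp only [fromBlocks_apply₁₂, fromBlocks_apply₂₂, Matrix.zero_apply, abs_zero,
      Finset.sum_const_zero, add_zero]
    exact hcol k

/-- OFF-EVENT (SCHUR) BOUND: with unsigned one-sided degrees `≤ L` (`0 < L`), every signing has
`tr(A_T^{2k}) ≤ (|α|+|β|)·L^{2k}`. -/
theorem trace_pow_le_schur [DecidableEq α] [DecidableEq β] (B : Fin m → Matrix α β ℝ)
    (hB : ∀ e i k, 0 ≤ B e i k) {L : ℝ} (hL : 0 < L)
    (hrow : ∀ i, ∑ e, ∑ k, B e i k ≤ L) (hcol : ∀ k, ∑ e, ∑ i, B e i k ≤ L)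
    (T : Fin m → Bool) (k : ℕ) :
    ((Matrix.fromBlocks (0 : Matrix α α ℝ) (sgnMat B T) (sgnMat B T)ᵀ (0 : Matrix β β ℝ))
        ^ (2 * k)).trace ≤ (Fintype.card α + Fintype.card β) * L ^ (2 * k) := by
  have hr : ∀ i, ∑ k, |sgnMat B T i k| ≤ L := fun i => (row_abs_sum_sgnMat_le B hB T i).trans (hrow i)
  have hc : ∀ k, ∑ i, |sgnMat B T i k| ≤ L := fun k => (col_abs_sum_sgnMat_le B hB T k).trans (hcol k)
  have h := trace_pow_le_of_rayleigh
    (Matrix.fromBlocks (0 : Matrix α α ℝ) (sgnMat B T) (sgnMat B T)ᵀ (0 : Matrix β β ℝ))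
    (fromBlocks_bipartite_isSymm _) hL
    (fun y => Literature.MathematicalPhysics.QuantumFieldTheory.Balaban1983to89.B2Sect3AGaussianStep.abs_quadForm_le_of_rowSum_le
      _ (fromBlocks_row_abs_sum_le _ hr hc) (fromBlocks_col_abs_sum_le _ hr hc) y) k
  simpa [Fintype.card_sum, Nat.cast_add] using h

/-- PROPOSITION 7 (averaged trace bound): see the module docstring. -/
theorem sum_trace_pow_le [DecidableEq α] [DecidableEq β] (B : Fin m → Matrix α β ℝ)
    (hB : ∀ e i k, 0 ≤ B e i k) (hlegs : ∀ e, ∑ i, ∑ k, B e i k ≤ 3) {L : ℝ} (hL : 0 < L)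
    (hrow : ∀ i, ∑ e, ∑ k, B e i k ≤ L) (hcol : ∀ k, ∑ e, ∑ i, B e i k ≤ L)
    (G : SimpleGraph (α ⊕ β)) [DecidableRel G.Adj]
    (hG : ∀ e i k, B e i k ≠ 0 → G.Adj (Sum.inl i) (Sum.inr k))
    {Ldeg : ℕ} (hdeg : ∀ x, G.degree x ≤ Ldeg)
    {γ' γsp : ℝ} (hγ' : 0 ≤ γ') (hγ : γ' ≤ γsp) (hγsp : 0 < γsp) (hγspL : γsp ≤ L) (t₀ : ℕ)
    (hsparse : ∀ (u : α → ℝ) (v : β → ℝ), (∀ i, u i = 0 ∨ u i = 1) → (∀ k, v k = 0 ∨ v k = 1) →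
      (G.induce {x | Sum.elim u v x = 1}).Connected → (∑ i, u i) + (∑ k, v k) ≤ t₀ →
      u ⬝ᵥ ((∑ e, B e) *ᵥ v) ≤ γsp * Real.sqrt ((∑ i, u i) * (∑ k, v k)))
    (k : ℕ) :
    ∑ T : Fin m → Bool,
        ((Matrix.fromBlocks (0 : Matrix α α ℝ) (sgnMat B T) (sgnMat B T)ᵀ (0 : Matrix β β ℝ))
          ^ (2 * k)).trace
      ≤ 2 ^ m * ((Fintype.card α + Fintype.card β)
            * (100 * (γsp * (Real.logb 2 (L / γsp) + 1))) ^ (2 * k))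
        + (2 ^ m * (2 * (Fintype.card α + Fintype.card β)
            * ∑ k' ∈ Finset.Ioc t₀ (Fintype.card α + Fintype.card β),
                (Ldeg : ℝ) ^ (2 * (k' - 1)) * Real.exp (-(γ' ^ 2 * k' / (12 * L)))))
          * ((Fintype.card α + Fintype.card β) * L ^ (2 * k)) := by
  classical
  set N : ℝ := (Fintype.card α : ℝ) + Fintype.card β with hN_def
  set ρ : ℝ := 100 * (γsp * (Real.logb 2 (L / γsp) + 1)) with hρ_def
  set bound : ℝ := 2 ^ m * (2 * (Fintype.card α + Fintype.card β : ℝ)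
      * ∑ k' ∈ Finset.Ioc t₀ (Fintype.card α + Fintype.card β),
          (Ldeg : ℝ) ^ (2 * (k' - 1)) * Real.exp (-(γ' ^ 2 * k' / (12 * L)))) with hbound_def
  let f : (Fin m → Bool) → ℝ := fun T =>
    ((Matrix.fromBlocks (0 : Matrix α α ℝ) (sgnMat B T) (sgnMat B T)ᵀ (0 : Matrix β β ℝ))
      ^ (2 * k)).trace
  let bad : (Fin m → Bool) → Prop := fun T =>
    ∃ S : Finset (α ⊕ β), (G.induce (S : Set (α ⊕ β))).Connected ∧ t₀ < S.card ∧
      γ' * Real.sqrt ((∑ i, (if Sum.inl i ∈ S then (1 : ℝ) else 0))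
            * (∑ k, (if Sum.inr k ∈ S then (1 : ℝ) else 0)))
        < |(fun i => if Sum.inl i ∈ S then (1 : ℝ) else 0) ⬝ᵥ
            (sgnMat B T *ᵥ (fun k => if Sum.inr k ∈ S then (1 : ℝ) else 0))|
  -- pointwise bounds
  have hgoodT : ∀ T, ¬ bad T → f T ≤ N * ρ ^ (2 * k) := by
    intro T hT
    refine trace_pow_le_of_good B hB G hG hγsp hγspL hγ hrow hcol t₀ T hsparse ?_ k
    intro u v hu hv hconn hsize
    by_contra hlt
    push Not at hlt
    apply hT
    let S : Finset (α ⊕ β) := Finset.univ.filter (fun x => Sum.elim u v x = 1)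
    have hSset : (S : Set (α ⊕ β)) = {x | Sum.elim u v x = 1} := by
      ext x; simp [S]
    have huS : (fun i => if Sum.inl i ∈ S then (1 : ℝ) else 0) = u := by
      funext i; rcases hu i with h | h <;> simp [S, h]
    have hvS : (fun k => if Sum.inr k ∈ S then (1 : ℝ) else 0) = v := by
      funext k; rcases hv k with h | h <;> simp [S, h]
    have hcardS : (∑ i, u i) + (∑ k, v k) = S.card := by
      have := sum_indicator_inl_add_inr S
      rw [show (∑ i : α, (if Sum.inl i ∈ S then (1 : ℝ) else 0)) = ∑ i, u i from by rw [← huS],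
        show (∑ k : β, (if Sum.inr k ∈ S then (1 : ℝ) else 0)) = ∑ k, v k from by rw [← hvS]] at this
      exact this
    refine ⟨S, by rw [hSset]; exact hconn, ?_, ?_⟩
    · have h1 : (t₀ : ℝ) < S.card := hsize.trans_eq hcardS
      exact_mod_cast h1
    · rw [huS, hvS]
      exact hlt
  have hbadT : ∀ T, f T ≤ N * L ^ (2 * k) := fun T => trace_pow_le_schur B hB hL hrow hcol T k
  -- the number of bad signings
  have hbadcard : ((Finset.univ.filter bad).card : ℝ) ≤ bound := by
    have h := card_badSignings_le B hB hlegs hL hrow hcol G hdeg hγ' t₀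
    rw [Nat.card_eq_fintype_card, Fintype.card_subtype] at h
    convert h using 1
  have hgoodcard : ((Finset.univ.filter (fun T => ¬ bad T)).card : ℝ) ≤ 2 ^ m := by
    have h1 : (Finset.univ.filter (fun T : Fin m → Bool => ¬ bad T)).card ≤ 2 ^ m := by
      calc (Finset.univ.filter (fun T : Fin m → Bool => ¬ bad T)).card
          ≤ (Finset.univ : Finset (Fin m → Bool)).card := Finset.card_filter_le _ _
        _ = 2 ^ m := by simp
    exact_mod_cast h1
  have hNρ : 0 ≤ N * ρ ^ (2 * k) := by
    have h2 : 0 ≤ ρ ^ (2 * k) := by rw [pow_mul]; exact pow_nonneg (sq_nonneg ρ) k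
    exact mul_nonneg (by positivity) h2
  have hNL : 0 ≤ N * L ^ (2 * k) := by positivity
  -- split the sum
  have hsplit := Finset.sum_filter_add_sum_filter_not (Finset.univ : Finset (Fin m → Bool)) bad f
  have hbadsum : ∑ T ∈ Finset.univ.filter bad, f T ≤ bound * (N * L ^ (2 * k)) := by
    calc ∑ T ∈ Finset.univ.filter bad, f T
        ≤ (Finset.univ.filter bad).card • (N * L ^ (2 * k)) :=
          Finset.sum_le_card_nsmul _ _ _ fun T _ => hbadT T
      _ = ((Finset.univ.filter bad).card : ℝ) * (N * L ^ (2 * k)) := nsmul_eq_mul _ _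
      _ ≤ bound * (N * L ^ (2 * k)) := mul_le_mul_of_nonneg_right hbadcard hNL
  have hgoodsum : ∑ T ∈ Finset.univ.filter (fun T => ¬ bad T), f T ≤ 2 ^ m * (N * ρ ^ (2 * k)) := by
    calc ∑ T ∈ Finset.univ.filter (fun T => ¬ bad T), f T
        ≤ (Finset.univ.filter (fun T => ¬ bad T)).card • (N * ρ ^ (2 * k)) :=
          Finset.sum_le_card_nsmul _ _ _ fun T hT => hgoodT T (Finset.mem_filter.1 hT).2
      _ = ((Finset.univ.filter (fun T => ¬ bad T)).card : ℝ) * (N * ρ ^ (2 * k)) := nsmul_eq_mul _ _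
      _ ≤ 2 ^ m * (N * ρ ^ (2 * k)) := mul_le_mul_of_nonneg_right hgoodcard hNρ
  have htot : ∑ T, f T ≤ 2 ^ m * (N * ρ ^ (2 * k)) + bound * (N * L ^ (2 * k)) := by
    rw [← hsplit]; linarith
  simpa [hN_def, hρ_def, hbound_def] using htot

/-- §6 NUMERICS FOR THE BAD-SIGNING WEIGHT: with `γ'² ≥ 144·L·ln L` (e.g. `γ'² = 100·L·log₂ L`), `Ldeg ≤ L`,
`L ≥ 2`: `Σ_{k∈(t₀,N]} Ldeg^{2(k-1)}·e^{−γ'²k/(12L)} ≤ 2·L^{−(10(t₀+1)+2)}`. -/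
theorem badWeight_le {L : ℝ} (hL : 2 ≤ L) {Ldeg : ℕ} (hLdeg : (Ldeg : ℝ) ≤ L) {γ' : ℝ}
    (hγ' : 144 * L * Real.log L ≤ γ' ^ 2) (t₀ N : ℕ) :
    ∑ k ∈ Finset.Ioc t₀ N, (Ldeg : ℝ) ^ (2 * (k - 1)) * Real.exp (-(γ' ^ 2 * k / (12 * L)))
      ≤ 2 * (L ^ (10 * (t₀ + 1) + 2))⁻¹ := by
  have hL0 : 0 < L := by linarith
  have hlog : 0 ≤ Real.log L := Real.log_nonneg (by linarith)
  -- termwise bound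
  have hterm : ∀ k ∈ Finset.Ioc t₀ N,
      (Ldeg : ℝ) ^ (2 * (k - 1)) * Real.exp (-(γ' ^ 2 * k / (12 * L))) ≤ (L ^ (10 * k + 2))⁻¹ := by
    intro k hk
    have hk1 : 1 ≤ k := by have := (Finset.mem_Ioc.1 hk).1; omega
    have h1 : (Ldeg : ℝ) ^ (2 * (k - 1)) ≤ L ^ (2 * (k - 1)) :=
      pow_le_pow_left₀ (Nat.cast_nonneg _) hLdeg _
    have h2 : Real.exp (-(γ' ^ 2 * k / (12 * L))) ≤ (L ^ (12 * k))⁻¹ := by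
      have hkey : (12 * k : ℝ) * Real.log L ≤ γ' ^ 2 * k / (12 * L) := by
        rw [le_div_iff₀ (by positivity)]
        have hk0 : (0 : ℝ) ≤ k := Nat.cast_nonneg k
        have := mul_le_mul_of_nonneg_right hγ' hk0
        calc (12 * k : ℝ) * Real.log L * (12 * L) = 144 * L * Real.log L * k := by ring
          _ ≤ γ' ^ 2 * k := this
      calc Real.exp (-(γ' ^ 2 * k / (12 * L)))
          ≤ Real.exp (-((12 * k : ℝ) * Real.log L)) := Real.exp_le_exp.2 (neg_le_neg hkey)
        _ = (L ^ (12 * k))⁻¹ := by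
            rw [Real.exp_neg, show (12 * k : ℝ) * Real.log L = ((12 * k : ℕ) : ℝ) * Real.log L by
              push_cast; ring, Real.exp_nat_mul, Real.exp_log hL0]
    have hprod : (L : ℝ) ^ (2 * (k - 1)) * (L ^ (12 * k))⁻¹ = (L ^ (10 * k + 2))⁻¹ := by
      have hsplit : (L : ℝ) ^ (12 * k) = L ^ (2 * (k - 1)) * L ^ (10 * k + 2) := by
        rw [← pow_add]; congr 1; omega
      rw [hsplit, mul_inv, ← mul_assoc, mul_inv_cancel₀ (pow_ne_zero _ hL0.ne'), one_mul]
    calc (Ldeg : ℝ) ^ (2 * (k - 1)) * Real.exp (-(γ' ^ 2 * k / (12 * L)))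
        ≤ L ^ (2 * (k - 1)) * (L ^ (12 * k))⁻¹ := mul_le_mul h1 h2 (by positivity) (by positivity)
      _ = (L ^ (10 * k + 2))⁻¹ := hprod
  -- geometric sum
  set x : ℝ := (L ^ 10)⁻¹ with hx_def
  have hx0 : 0 ≤ x := by positivity
  have hL10 : (2 : ℝ) ≤ L ^ 10 := by
    calc (2 : ℝ) ≤ 2 ^ 10 := by norm_num
      _ ≤ L ^ 10 := pow_le_pow_left₀ (by norm_num) hL 10
  have hx1 : x ≤ 1 / 2 := by
    rw [hx_def, inv_le_comm₀ (by positivity) (by norm_num)]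
    simpa using hL10
  have hIoc : Finset.Ioc t₀ N = Finset.Ico (t₀ + 1) (N + 1) := by
    ext k; simp only [Finset.mem_Ioc, Finset.mem_Ico]; omega
  have hpow : ∀ k : ℕ, (L ^ (10 * k + 2))⁻¹ = (L ^ 2)⁻¹ * x ^ k := by
    intro k; rw [hx_def, inv_pow, ← pow_mul, pow_add, mul_inv, mul_comm]
  calc ∑ k ∈ Finset.Ioc t₀ N, (Ldeg : ℝ) ^ (2 * (k - 1)) * Real.exp (-(γ' ^ 2 * k / (12 * L)))
      ≤ ∑ k ∈ Finset.Ioc t₀ N, (L ^ (10 * k + 2))⁻¹ := Finset.sum_le_sum hterm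
    _ = (L ^ 2)⁻¹ * ∑ k ∈ Finset.Ico (t₀ + 1) (N + 1), x ^ k := by
        rw [hIoc, Finset.mul_sum]
        exact Finset.sum_congr rfl fun k _ => hpow k
    _ ≤ (L ^ 2)⁻¹ * (x ^ (t₀ + 1) / (1 - x)) :=
        mul_le_mul_of_nonneg_left (geom_sum_Ico_le_of_lt_one hx0 (by linarith)) (by positivity)
    _ ≤ (L ^ 2)⁻¹ * (2 * x ^ (t₀ + 1)) := by
        refine mul_le_mul_of_nonneg_left ?_ (by positivity)
        rw [div_le_iff₀ (by linarith)]
        nlinarith [pow_nonneg hx0 (t₀ + 1)]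
    _ = 2 * (L ^ (10 * (t₀ + 1) + 2))⁻¹ := by
        rw [hpow (t₀ + 1)]; ring


/-- PROPOSITION 7, EXPLICIT FORM (§6 input): with `γ'² ≥ 144·L·ln L` (e.g. `γ' = √(100·L·log₂L)`), `Ldeg ≤ L`,
`2 ≤ L`: `Σ_T tr(A_T^{2k}) ≤ 2^m·N·ρ^{2k} + 2^m·4N²·L^{2k}·L^{−(10(t₀+1)+2)}`, `ρ = 100γ_sp(log₂(L/γ_sp)+1)`;
so `E_T tr ≤ Nρ^{2k} + 1` as soon as `4N²L^{2k} ≤ L^{10(t₀+1)+2}`. -/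
theorem sum_trace_pow_le_explicit [DecidableEq α] [DecidableEq β] (B : Fin m → Matrix α β ℝ)
    (hB : ∀ e i k, 0 ≤ B e i k) (hlegs : ∀ e, ∑ i, ∑ k, B e i k ≤ 3) {L : ℝ} (hL : 2 ≤ L)
    (hrow : ∀ i, ∑ e, ∑ k, B e i k ≤ L) (hcol : ∀ k, ∑ e, ∑ i, B e i k ≤ L)
    (G : SimpleGraph (α ⊕ β)) [DecidableRel G.Adj]
    (hG : ∀ e i k, B e i k ≠ 0 → G.Adj (Sum.inl i) (Sum.inr k))
    {Ldeg : ℕ} (hdeg : ∀ x, G.degree x ≤ Ldeg) (hLdeg : (Ldeg : ℝ) ≤ L)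
    {γ' γsp : ℝ} (hγ' : 0 ≤ γ') (hγ'L : 144 * L * Real.log L ≤ γ' ^ 2) (hγ : γ' ≤ γsp)
    (hγsp : 0 < γsp) (hγspL : γsp ≤ L) (t₀ : ℕ)
    (hsparse : ∀ (u : α → ℝ) (v : β → ℝ), (∀ i, u i = 0 ∨ u i = 1) → (∀ k, v k = 0 ∨ v k = 1) →
      (G.induce {x | Sum.elim u v x = 1}).Connected → (∑ i, u i) + (∑ k, v k) ≤ t₀ →
      u ⬝ᵥ ((∑ e, B e) *ᵥ v) ≤ γsp * Real.sqrt ((∑ i, u i) * (∑ k, v k)))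
    (k : ℕ) :
    ∑ T : Fin m → Bool,
        ((Matrix.fromBlocks (0 : Matrix α α ℝ) (sgnMat B T) (sgnMat B T)ᵀ (0 : Matrix β β ℝ))
          ^ (2 * k)).trace
      ≤ 2 ^ m * ((Fintype.card α + Fintype.card β)
            * (100 * (γsp * (Real.logb 2 (L / γsp) + 1))) ^ (2 * k))
        + 2 ^ m * (4 * (Fintype.card α + Fintype.card β) ^ 2 * L ^ (2 * k)
            * (L ^ (10 * (t₀ + 1) + 2))⁻¹) := by
  have hL0 : 0 < L := by linarith
  have h := sum_trace_pow_le B hB hlegs hL0 hrow hcol G hG hdeg hγ' hγ hγsp hγspL t₀ hsparse k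
  have hW := badWeight_le hL hLdeg hγ'L t₀ (Fintype.card α + Fintype.card β)
  set N : ℝ := (Fintype.card α : ℝ) + Fintype.card β with hN_def
  have hN : 0 ≤ N := by positivity
  set W : ℝ := ∑ k' ∈ Finset.Ioc t₀ (Fintype.card α + Fintype.card β),
      (Ldeg : ℝ) ^ (2 * (k' - 1)) * Real.exp (-(γ' ^ 2 * k' / (12 * L))) with hW_def
  have hstep : 2 ^ m * (2 * N * W) * (N * L ^ (2 * k))
      ≤ 2 ^ m * (2 * N * (2 * (L ^ (10 * (t₀ + 1) + 2))⁻¹)) * (N * L ^ (2 * k)) := by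
    gcongr
  have hre : 2 ^ m * (2 * N * (2 * (L ^ (10 * (t₀ + 1) + 2))⁻¹)) * (N * L ^ (2 * k))
      = 2 ^ m * (4 * N ^ 2 * L ^ (2 * k) * (L ^ (10 * (t₀ + 1) + 2))⁻¹) := by ring
  have h' : ∑ T : Fin m → Bool,
        ((Matrix.fromBlocks (0 : Matrix α α ℝ) (sgnMat B T) (sgnMat B T)ᵀ (0 : Matrix β β ℝ))
          ^ (2 * k)).trace
      ≤ 2 ^ m * (N * (100 * (γsp * (Real.logb 2 (L / γsp) + 1))) ^ (2 * k))
        + 2 ^ m * (2 * N * W) * (N * L ^ (2 * k)) := by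
    simpa [hN_def, hW_def] using h
  linarith [h', hstep, hre]

end Summit.PneNP.PneNP.Theorems.SfmBl
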